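import Summits.QuantumFields.YangMills.Theorems.FluctuationComparisonRegPrIntLPolymerTreeKnit
import HarnessLib

/-!
# THE BACKGROUND-FORM PACKAGE OF AN EXACTLY-LOCAL POLYMER PACKAGE (abstract encoding; helper for `…BackgroundFormOfPolymer`)

Cell `ym3-torus` (rung R3 = continuum `SU(2)` Yang–Mills on T³ — NOT d = 4, NOT infinite volume, NOT a mass gap, NOT Clay).  Crux of record
`stmt-QuantumFields-20520` = `UnitScaleTilt.FluctuationComparisonRegPrIntL` (DECIDING); HELPER file (`--supports`), closes nothing, registers nothing.
The sequel `…Theorems.FluctuationComparisonRegPrIntLBackgroundFormOfPolymer` proves ★`backgroundForm_of_polymer : ⟨POLY∘⟩ → ⟨BGFORM∘⟩` (LINE g24-4's row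
`FluctuationBackgroundFormCan` from LINE g24-3's row `FluctuationPolymerCan`, texts verbatim there).  This file is the ENCODING for ONE window, abstract in the
window-bond type `β`, the fine-bond type `E`, the window set `S ⊆ (β → G)` and the value type `G` (`backgroundForm_package`, §2).  Given terms `T X` exactly local
in the field on `X` (i) with one-bond oscillation moduli `w X` (ii) whose two-pin sums are `≤ φ e^{−κ t}` (iv), a pseudo-metric `t` on `β` with
`Σ_{b′} e^{−(κ∕4)t(b,b′)} ≤ C₁`, and an injective anchor `π : β → E`, it produces: the pseudo-metric `d` on `E` (`d (π b) (π b′) := (κ∕4)·t b b′`, and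
`d := Dbig := #E + Σ_{pairs}(κ∕4)t` as soon as one point is off `range π`; `Σ_y e^{−d(x,y)} ≤ C₁ + 1` uniformly since `#E·e^{−#E} ≤ 1`; `(κ∕4)t ≤ d ∘ π`); the
BACKGROUND MAP := the bond-distributed term values `M U (π b) := (Σ_{X ∋ b} T X U ∕ #X)·(1,…,1)`, `0` off `range π`; ONE term, the LINEAR readout
`T′ univ m := Σ_e (m e) 0` (else `0`), moduli `ℓ univ := 1` (else `0`), `h := 0`, so BGFORM∘'s Lipschitz and discrete-C¹·¹ clauses hold EXACTLY (§1) and the pin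
sums are `≤ 1` ∕ `≤ 0`; the RESPONSE bounds, which ARE POLY∘'s pinned sums after locality (one bond: `≤ Σ_{X ∋ b,b″} w X ≤ φe^{−κt} ≤ φe^{−(κ∕2)t}`; a
`(b,b′)`-square: `≤ 2Σ_{X ∋ b,b′,b″} w X ≤ 2φ e^{−κ·max(t₁,t₂)} ≤ 2φ e^{−(κ∕2)(t₁+t₂)}`); and the resummation `Σ_X T′ X (M U) = Σ_X T X U − T ∅ U`.  §1 also
proves `sum_bond_exp_neg_tdist_le`: `Σ_{b′} e^{−a·tdist(b₋,b′₋)} ≤ 3·K₁(3,a)` on every level-`J` bond torus of a `T3Family` ([Balaban1987RG1] (5.10)'s periodic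
`ℓ¹` sum via ✓`exists_siteEquiv_pl1`, ✓`sum_exp_pl1_le_K₁`; three bonds per site).  WHY NOT the card's `M U := coordinates of U`, `d := D·[x ≠ y]`: BGFORM∘'s
Lipschitz clause quantifies over ARBITRARY window pairs while POLY∘ only bounds one-bond OSCILLATIONS, and `Σ_y e^{−μD[x≠y]}` is not volume-uniform.
HONEST: finite-sum bookkeeping; no Literature fact used or restated; nothing of Bałaban's asserted; no row, organ, crux or summit proved; rung R3 only.
-/

noncomputable section

namespace Summit.QuantumFields.YangMills.Theorems.FluctuationComparisonRegPrIntLBackgroundFormOfPolymerPackage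

open MeasureTheory Filter Topology Set
open scoped BigOperators
open Literature.MathematicalPhysics.QuantumFieldTheory.Balaban1983to89
open Literature.MathematicalPhysics.QuantumFieldTheory.Balaban1983to89.T3ContinuumYM3Torus
open Literature.MathematicalPhysics.QuantumFieldTheory.Balaban1983to89.T3NestedUnitLaws
open Literature.MathematicalPhysics.QuantumFieldTheory.Balaban1983to89.T3UnitLawDensityEML
open Literature.MathematicalPhysics.QuantumFieldTheory.Balaban1983to89.T3UnitScaleTilt
open Literature.MathematicalPhysics.QuantumFieldTheory.Balaban1983to89.T3TiltDescent
open Literature.MathematicalPhysics.QuantumFieldTheory.Balaban1983to89.T3PrintedRegularMinimiser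
open Literature.MathematicalPhysics.QuantumFieldTheory.Balaban1983to89.T3LevelShift
open Literature.MathematicalPhysics.QuantumFieldTheory.Balaban1983to89.Missing
open Literature.MathematicalPhysics.QuantumFieldTheory.Balaban1983to89.T4Continuum
open Literature.MathematicalPhysics.QuantumFieldTheory.Balaban1983to89.B12Decay510Torus (pl1 pl1_sub_comm pl1_sub_triangle sum_exp_pl1_le_K₁)
open Literature.MathematicalPhysics.QuantumFieldTheory.Balaban1983to89.B12Decay510Window (K₁ K₁_nonneg)
open Summit.QuantumFields.YangMills.Theorems.FluctuationComparisonRegPrIntLPolymerTreeKnit (exists_siteEquiv_pl1)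

/-! ## §1 Elementary pieces -/

section Pieces

variable {E : Type*}

/-- The linear readout `m ↦ Σ_{e ∈ X} (m e) 0` is `1`-Lipschitz for the `ℓ¹`-sum of sup norms. [folklore] -/
theorem abs_sum_apply_sub_le (X : Finset E) (m m' : E → (Fin 8 → ℝ)) :
    |∑ e ∈ X, m e 0 - ∑ e ∈ X, m' e 0| ≤ ∑ e ∈ X, ‖m e - m' e‖ := by
  rw [← Finset.sum_sub_distrib]
  refine (Finset.abs_sum_le_sum_abs _ _).trans (Finset.sum_le_sum fun e _ => ?_)
  have h := norm_le_pi_norm (m e - m' e) 0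
  rwa [Pi.sub_apply, Real.norm_eq_abs] at h

/-- The linear readout has vanishing discrete second differences up to the readout of the second difference of its argument. [folklore] -/
theorem abs_sum_apply_sub_sub_add_le (X : Finset E) (m₁ m₂ m₃ m₄ : E → (Fin 8 → ℝ)) :
    |∑ e ∈ X, m₁ e 0 - ∑ e ∈ X, m₂ e 0 - ∑ e ∈ X, m₃ e 0 + ∑ e ∈ X, m₄ e 0| ≤
      ∑ e ∈ X, ‖m₁ e - m₂ e - m₃ e + m₄ e‖ := by
  rw [← Finset.sum_sub_distrib, ← Finset.sum_sub_distrib, ← Finset.sum_add_distrib]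
  refine (Finset.abs_sum_le_sum_abs _ _).trans (Finset.sum_le_sum fun e _ => ?_)
  have h := norm_le_pi_norm (m₁ e - m₂ e - m₃ e + m₄ e) 0
  rwa [Pi.add_apply, Pi.sub_apply, Pi.sub_apply, Real.norm_eq_abs] at h

/-- `n · e^{−n} ≤ 1`. [folklore] -/
theorem natCast_mul_exp_neg_le_one (n : ℕ) : (n : ℝ) * Real.exp (-(n : ℝ)) ≤ 1 := by
  have h1 : (n : ℝ) ≤ Real.exp n := by linarith [Real.add_one_le_exp (n : ℝ)]
  rw [Real.exp_neg, ← div_eq_mul_inv, div_le_one (Real.exp_pos _)]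
  exact h1

/-- `min`-to-geometric-mean step: a quantity below `φe^{−κt₁}` and below `φe^{−κt₂}` is below `φ e^{−(κ∕2)t₁} e^{−(κ∕2)t₂}` (written with the rate
`2·1·(κ∕4)` of §2). [folklore] -/
theorem le_mul_exp_half_add {s φ κ t₁ t₂ : ℝ} (hφ : 0 ≤ φ) (hκ : 0 ≤ κ)
    (h₁ : s ≤ φ * Real.exp (-(κ * t₁))) (h₂ : s ≤ φ * Real.exp (-(κ * t₂))) :
    s ≤ φ * (Real.exp (-(2 * 1 * (κ / 4 * t₁))) * Real.exp (-(2 * 1 * (κ / 4 * t₂)))) := by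
  rw [← Real.exp_add]
  rcases le_total t₁ t₂ with h | h
  · refine h₂.trans (mul_le_mul_of_nonneg_left (Real.exp_le_exp.mpr ?_) hφ)
    nlinarith [mul_nonneg hκ (sub_nonneg.mpr h)]
  · refine h₁.trans (mul_le_mul_of_nonneg_left (Real.exp_le_exp.mpr ?_) hφ)
    nlinarith [mul_nonneg hκ (sub_nonneg.mpr h)]

end Pieces

/-- **Uniform bond-torus sums**: `Σ_{b′} e^{−a·tdist(b₋, b′₋)} ≤ 3·K₁(3, a)` on the level-`J` bond torus of every member of a `T3Family`, for `a > 0` — three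
bonds per site, and the site sum is the periodic `ℓ¹` sum of [Balaban1987RG1] (5.10) through the isometry ✓`exists_siteEquiv_pl1` and ✓`sum_exp_pl1_le_K₁`.
[cite: Balaban1987RG1, (5.10) p.293] -/
theorem sum_bond_exp_neg_tdist_le (F : T3Family) (J : ℕ) {a : ℝ} (ha : 0 < a) (b : PBond (F.P J) 0) :
    ∑ b' : PBond (F.P J) 0, Real.exp (-(a * (b.src.tdist b'.src : ℝ))) ≤ 3 * K₁ 3 a := by
  classical
  obtain ⟨e, -, he⟩ := exists_siteEquiv_pl1 F J (N := (F.P J).sitesPerDir 0) (M := 1) (by simp)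
  have hsite : ∀ x : Site (F.P J) 0, ∑ y : Site (F.P J) 0, Real.exp (-(a * (x.tdist y : ℝ))) ≤ K₁ 3 a := by
    intro x
    have h1 : ∑ y : Site (F.P J) 0, Real.exp (-(a * (x.tdist y : ℝ))) =
        ∑ y : Site (F.P J) 0, Real.exp (-a * pl1 ((Equiv.subLeft (e x)) (e y))) := by
      refine Finset.sum_congr rfl fun y _ => ?_
      rw [he, Equiv.subLeft_apply, neg_mul]
    rw [h1]
    calc ∑ y : Site (F.P J) 0, Real.exp (-a * pl1 ((Equiv.subLeft (e x)) (e y)))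
        = ∑ w, Real.exp (-a * pl1 w) := Equiv.sum_comp (e.trans (Equiv.subLeft (e x))) (fun w => Real.exp (-a * pl1 w))
      _ ≤ K₁ 3 a := sum_exp_pl1_le_K₁ ha
  let eqv : PBond (F.P J) 0 ≃ Site (F.P J) 0 × Fin (F.P J).d :=
    ⟨fun b' => (b'.src, b'.dir), fun p => ⟨p.1, p.2⟩, fun _ => rfl, fun _ => rfl⟩
  have h2 : ∑ b' : PBond (F.P J) 0, Real.exp (-(a * (b.src.tdist b'.src : ℝ))) =
      ∑ p : Site (F.P J) 0 × Fin (F.P J).d, Real.exp (-(a * (b.src.tdist p.1 : ℝ))) :=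
    (Equiv.sum_comp eqv.symm (fun b' : PBond (F.P J) 0 => Real.exp (-(a * (b.src.tdist b'.src : ℝ))))).symm
  rw [h2, Fintype.sum_prod_type]
  calc ∑ y : Site (F.P J) 0, ∑ _i : Fin (F.P J).d, Real.exp (-(a * (b.src.tdist y : ℝ)))
      = ∑ y : Site (F.P J) 0, 3 * Real.exp (-(a * (b.src.tdist y : ℝ))) := by
        refine Finset.sum_congr rfl fun y _ => ?_
        rw [Finset.sum_const, Finset.card_univ, Fintype.card_fin, T3Family.P_d, nsmul_eq_mul, Nat.cast_ofNat]
    _ = 3 * ∑ y : Site (F.P J) 0, Real.exp (-(a * (b.src.tdist y : ℝ))) := by rw [Finset.mul_sum]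
    _ ≤ 3 * K₁ 3 a := by have := hsite b.src; linarith

/-! ## §2 The encoding for one window (abstract) -/

/-- **The background-form package of an exactly-local polymer package** (one window; abstract in the window-bond type `β`, the fine-bond type `E`, the window
set `S ⊆ (β → G)` and the value type `G`).  DATA: a pseudo-metric `t` on `β` with `Σ_{b′} e^{−(κ∕4)t(b,b′)} ≤ C₁`; an injection `π : β → E`; terms `T X`
exactly local in the field on `X` (i) with one-bond oscillation moduli `w X` (ii) whose two-pin sums are `≤ φ e^{−κ t}` (iv).  OUTPUT: a pseudo-metric `d` on
`E` (`= (κ∕4)·t` on `range π`, `= Dbig` off it) with `Σ_y e^{−d(x,y)} ≤ C₁ + 1` and `(κ∕4)t ≤ d ∘ π`; the background map `M U (π b) := (Σ_{X ∋ b} T X U ∕ #X)·𝟙`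
(`0` off `range π`); the single linear term `T′ univ m := Σ_e (m e) 0` with moduli `ℓ univ := 1`, `h := 0` (one-pin sums `≤ 1`, two-pin sums `≤ 0`); the
Lipschitz and C¹·¹ clauses (exact, §1); the one-bond response `≤ φ e^{−2·1·d(πb, e)}` and the mixed two-bond response `≤ 2φ e^{−2·1·d(πb,e)} e^{−2·1·d(e,πb′)}`
(POLY∘'s pinned sums after locality); and the resummation `Σ_X T′ X (M U) = Σ_X T X U − T ∅ U`. [folklore] -/
theorem backgroundForm_package {β E G : Type*} [Fintype β] [DecidableEq β] [Nonempty β] [Fintype E] [DecidableEq E]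
    (S : Set (β → G)) (t : β → β → ℝ) (ht0 : ∀ b b', 0 ≤ t b b') (htsymm : ∀ b b', t b b' = t b' b)
    (httri : ∀ b b' b'', t b b'' ≤ t b b' + t b' b'')
    (π : β → E) (hπ : Function.Injective π)
    (T : Finset β → (β → G) → ℝ) (w : Finset β → ℝ) {κ φ C₁ : ℝ} (hκ : 0 < κ) (hφ : 0 ≤ φ) (hC₁ : 0 ≤ C₁)
    (hi : ∀ (X : Finset β) (U V : β → G), (∀ e ∈ X, U e = V e) → T X U = T X V)
    (hii : ∀ (X : Finset β) (b : β) (U V : β → G), U ∈ S → V ∈ S → (∀ e, e ≠ b → U e = V e) → |T X U - T X V| ≤ w X)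
    (hiv : ∀ b b' : β, ∑ X ∈ Finset.univ.filter (fun X => b ∈ X ∧ b' ∈ X), w X ≤ φ * Real.exp (-(κ * t b b')))
    (hsum : ∀ b : β, ∑ b' : β, Real.exp (-(κ / 4 * t b b')) ≤ C₁) :
    ∃ (d : E → E → ℝ) (M : (β → G) → E → (Fin 8 → ℝ)) (T' : Finset E → (E → (Fin 8 → ℝ)) → ℝ) (ℓ h : Finset E → ℝ),
      (∀ x y, 0 ≤ d x y) ∧ (∀ x y, d x y = d y x) ∧ (∀ x y z, d x z ≤ d x y + d y z) ∧
      (∀ x, ∑ y, Real.exp (-(1 * d x y)) ≤ C₁ + 1) ∧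
      (∀ b b' : β, κ / 4 * t b b' ≤ 1 * d (π b) (π b')) ∧
      (∀ X, 0 ≤ ℓ X) ∧ (∀ X, 0 ≤ h X) ∧
      (∀ e, ∑ X ∈ Finset.univ.filter (fun X => e ∈ X), ℓ X ≤ 1) ∧
      (∀ e e', ∑ X ∈ Finset.univ.filter (fun X => e ∈ X ∧ e' ∈ X), h X ≤ 0 * Real.exp (-(2 * 1 * d e e'))) ∧
      (∀ (X : Finset E) (U V : β → G), U ∈ S → V ∈ S →
          |T' X (M U) - T' X (M V)| ≤ ℓ X * ∑ e ∈ X, ‖M U e - M V e‖) ∧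
      (∀ (X : Finset E) (U V W Z : β → G), U ∈ S → V ∈ S → W ∈ S → Z ∈ S →
          |T' X (M U) - T' X (M W) - T' X (M V) + T' X (M Z)| ≤
            h X * (∑ e ∈ X, ‖M W e - M Z e‖) * (∑ e ∈ X, ‖M V e - M Z e‖) +
              ℓ X * ∑ e ∈ X, ‖M U e - M W e - M V e + M Z e‖) ∧
      (∀ (b : β) (U V : β → G), U ∈ S → V ∈ S → (∀ e, e ≠ b → U e = V e) →
          ∀ e, ‖M U e - M V e‖ ≤ φ * Real.exp (-(2 * 1 * d (π b) e))) ∧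
      (∀ (b b' : β) (U V W Z : β → G), U ∈ S → V ∈ S → W ∈ S → Z ∈ S →
          (∀ e, e ≠ b → U e = V e) → (∀ e, e ≠ b' → U e = W e) → (∀ e, e ≠ b' → V e = Z e) → (∀ e, e ≠ b → W e = Z e) →
          ∀ e, ‖M U e - M W e - M V e + M Z e‖ ≤
            2 * φ * (Real.exp (-(2 * 1 * d (π b) e)) * Real.exp (-(2 * 1 * d e (π b'))))) ∧
      (∀ U : β → G, ∑ X, T' X (M U) = ∑ X, T X U - T ∅ U) := by
  classical
  -- the bond-distributed term values
  set f : β → (β → G) → ℝ := fun b U => ∑ X ∈ Finset.univ.filter (fun X => b ∈ X), T X U / (X.card : ℝ) with hf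
  set M : (β → G) → E → (Fin 8 → ℝ) := fun U e _ => ∑ b ∈ Finset.univ.filter (fun b => π b = e), f b U with hM
  set T' : Finset E → (E → (Fin 8 → ℝ)) → ℝ := fun X m => if X = Finset.univ then ∑ e, m e 0 else 0 with hT'
  set ℓ : Finset E → ℝ := fun X => if X = Finset.univ then 1 else 0 with hℓ
  set Dbig : ℝ := (Fintype.card E : ℝ) + ∑ b : β, ∑ b' : β, κ / 4 * t b b' with hDbig
  set d : E → E → ℝ := fun x y =>
    if x ∈ Set.range π ∧ y ∈ Set.range π then κ / 4 * t (Function.invFun π x) (Function.invFun π y) else Dbig with hd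
  have hκ4 : 0 ≤ κ / 4 := by positivity
  have hkt : ∀ b b', 0 ≤ κ / 4 * t b b' := fun b b' => mul_nonneg hκ4 (ht0 b b')
  have hDt : ∀ b b', κ / 4 * t b b' ≤ Dbig := by
    intro b b'
    have h1 : κ / 4 * t b b' ≤ ∑ b'' : β, κ / 4 * t b b'' :=
      Finset.single_le_sum (f := fun b'' => κ / 4 * t b b'') (fun b'' _ => hkt b b'') (Finset.mem_univ b')
    have h2 : ∑ b'' : β, κ / 4 * t b b'' ≤ ∑ b₁ : β, ∑ b'' : β, κ / 4 * t b₁ b'' :=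
      Finset.single_le_sum (f := fun b₁ => ∑ b'' : β, κ / 4 * t b₁ b'') (fun b₁ _ => Finset.sum_nonneg fun b'' _ => hkt b₁ b'')
        (Finset.mem_univ b)
    have h3 : (0 : ℝ) ≤ Fintype.card E := Nat.cast_nonneg _
    rw [hDbig]; linarith
  have hD0 : 0 ≤ Dbig := (hkt (Classical.arbitrary β) (Classical.arbitrary β)).trans (hDt _ _)
  have hDcard : (Fintype.card E : ℝ) ≤ Dbig := by
    rw [hDbig]
    have := Finset.sum_nonneg fun b₁ (_ : b₁ ∈ (Finset.univ : Finset β)) => Finset.sum_nonneg fun b'' (_ : b'' ∈ Finset.univ) => hkt b₁ b''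
    linarith
  have hinv : ∀ b, Function.invFun π (π b) = b := fun b => Function.leftInverse_invFun hπ b
  have hdπ : ∀ b b', d (π b) (π b') = κ / 4 * t b b' := by
    intro b b'
    simp only [hd, Set.mem_range_self, and_self, if_true, hinv]
  have hdoff : ∀ x y, ¬ (x ∈ Set.range π ∧ y ∈ Set.range π) → d x y = Dbig := by
    intro x y hxy
    simp only [hd, if_neg hxy]
  have hd0' : ∀ x y, 0 ≤ d x y := by
    intro x y
    by_cases hxy : x ∈ Set.range π ∧ y ∈ Set.range π
    · simp only [hd, if_pos hxy]; exact hkt _ _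
    · rw [hdoff x y hxy]; exact hD0
  -- fibre of the anchor
  have hfib : ∀ b, Finset.univ.filter (fun b' => π b' = π b) = {b} := by
    intro b; ext b'; simp [hπ.eq_iff]
  have hfib0 : ∀ e, e ∉ Set.range π → Finset.univ.filter (fun b' => π b' = e) = ∅ := by
    intro e he
    ext b'
    simp only [Finset.mem_filter, Finset.mem_univ, true_and, Finset.notMem_empty, iff_false]
    exact fun h => he ⟨b', h⟩
  have hMπ : ∀ U b, M U (π b) = fun _ => f b U := by
    intro U b; funext i; simp only [hM, hfib, Finset.sum_singleton]
  have hMoff : ∀ U e, e ∉ Set.range π → M U e = 0 := by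
    intro U e he; funext i; simp only [hM, hfib0 e he, Finset.sum_empty, Pi.zero_apply]
  -- nonnegativity of the moduli on a nonempty window
  have hw : ∀ U, U ∈ S → ∀ X, 0 ≤ w X := fun U hU X =>
    (abs_nonneg _).trans (hii X (Classical.arbitrary β) U U hU hU fun _ _ => rfl)
  -- one-bond move: the distributed values at b'' move by at most the (b, b'')-pinned sum
  have hR1 : ∀ (b : β) (U V : β → G), U ∈ S → V ∈ S → (∀ e, e ≠ b → U e = V e) →
      ∀ b'', |f b'' U - f b'' V| ≤ ∑ X ∈ Finset.univ.filter (fun X => b'' ∈ X ∧ b ∈ X), w X := by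
    intro b U V hU hV hUV b''
    have h1 : f b'' U - f b'' V = ∑ X ∈ Finset.univ.filter (fun X => b'' ∈ X), (T X U - T X V) / (X.card : ℝ) := by
      simp only [hf, ← Finset.sum_sub_distrib, sub_div]
    rw [h1]
    refine (Finset.abs_sum_le_sum_abs _ _).trans ?_
    have h2 : ∀ X ∈ Finset.univ.filter (fun X => b'' ∈ X), |(T X U - T X V) / (X.card : ℝ)| ≤ if b ∈ X then w X else 0 := by
      intro X hX
      have hXne : X.Nonempty := ⟨b'', (Finset.mem_filter.mp hX).2⟩
      have hc : (1 : ℝ) ≤ X.card := by exact_mod_cast hXne.card_pos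
      rw [abs_div, abs_of_pos (by positivity : (0 : ℝ) < X.card)]
      refine (div_le_self (abs_nonneg _) hc).trans ?_
      split_ifs with hb
      · exact hii X b U V hU hV hUV
      · rw [hi X U V fun e he => hUV e fun h => hb (h ▸ he), sub_self, abs_zero]
    refine (Finset.sum_le_sum h2).trans (le_of_eq ?_)
    rw [← Finset.sum_filter, Finset.filter_filter]
  -- the square: the distributed values at b'' have mixed differences bounded by twice the (b, b', b'')-pinned sum
  have hR2 : ∀ (b b' : β) (U V W Z : β → G), U ∈ S → V ∈ S → W ∈ S → Z ∈ S →
      (∀ e, e ≠ b → U e = V e) → (∀ e, e ≠ b' → U e = W e) → (∀ e, e ≠ b' → V e = Z e) → (∀ e, e ≠ b → W e = Z e) →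
      ∀ b'', |f b'' U - f b'' W - f b'' V + f b'' Z| ≤
        2 * ∑ X ∈ Finset.univ.filter (fun X => b'' ∈ X ∧ (b ∈ X ∧ b' ∈ X)), w X := by
    intro b b' U V W Z hU hV hW hZ hUV hUW hVZ hWZ b''
    have h1 : f b'' U - f b'' W - f b'' V + f b'' Z =
        ∑ X ∈ Finset.univ.filter (fun X => b'' ∈ X), (T X U - T X W - T X V + T X Z) / (X.card : ℝ) := by
      simp only [hf, ← Finset.sum_sub_distrib, ← Finset.sum_add_distrib]
      refine Finset.sum_congr rfl fun X _ => ?_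
      ring
    rw [h1]
    refine (Finset.abs_sum_le_sum_abs _ _).trans ?_
    have h2 : ∀ X ∈ Finset.univ.filter (fun X => b'' ∈ X),
        |(T X U - T X W - T X V + T X Z) / (X.card : ℝ)| ≤ if b ∈ X ∧ b' ∈ X then 2 * w X else 0 := by
      intro X hX
      have hXne : X.Nonempty := ⟨b'', (Finset.mem_filter.mp hX).2⟩
      have hc : (1 : ℝ) ≤ X.card := by exact_mod_cast hXne.card_pos
      rw [abs_div, abs_of_pos (by positivity : (0 : ℝ) < X.card)]
      refine (div_le_self (abs_nonneg _) hc).trans ?_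
      split_ifs with hb
      · have hA : |T X U - T X W| ≤ w X := hii X b' U W hU hW hUW
        have hB : |T X V - T X Z| ≤ w X := hii X b' V Z hV hZ hVZ
        calc |T X U - T X W - T X V + T X Z| = |(T X U - T X W) - (T X V - T X Z)| := by ring_nf
          _ ≤ |T X U - T X W| + |T X V - T X Z| := abs_sub _ _
          _ ≤ 2 * w X := by linarith
      · rcases not_and_or.mp hb with hb₁ | hb₂
        · rw [hi X U V fun e he => hUV e fun h => hb₁ (h ▸ he), hi X W Z fun e he => hWZ e fun h => hb₁ (h ▸ he)]
          rw [show T X V - T X Z - T X V + T X Z = 0 by ring, abs_zero]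
        · rw [hi X U W fun e he => hUW e fun h => hb₂ (h ▸ he), hi X V Z fun e he => hVZ e fun h => hb₂ (h ▸ he)]
          rw [show T X W - T X W - T X Z + T X Z = 0 by ring, abs_zero]
    refine (Finset.sum_le_sum h2).trans (le_of_eq ?_)
    rw [← Finset.sum_filter, Finset.filter_filter, Finset.mul_sum]
  refine ⟨d, M, T', ℓ, fun _ => 0, hd0', ?_, ?_, ?_, ?_, ?_, fun _ => le_rfl, ?_, ?_, ?_, ?_, ?_, ?_, ?_⟩
  · -- symmetry
    intro x y
    by_cases hx : x ∈ Set.range π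
    · by_cases hy : y ∈ Set.range π
      · simp only [hd, if_pos (And.intro hx hy), if_pos (And.intro hy hx)]
        rw [htsymm]
      · rw [hdoff x y (fun h => hy h.2), hdoff y x (fun h => hy h.1)]
    · rw [hdoff x y (fun h => hx h.1), hdoff y x (fun h => hx h.2)]
  · -- triangle inequality
    intro x y z
    by_cases hz : z ∈ Set.range π
    · by_cases hx : x ∈ Set.range π
      · by_cases hy : y ∈ Set.range π
        · simp only [hd, if_pos (And.intro hx hz), if_pos (And.intro hx hy), if_pos (And.intro hy hz)]
          calc κ / 4 * t (Function.invFun π x) (Function.invFun π z)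
              ≤ κ / 4 * (t (Function.invFun π x) (Function.invFun π y) + t (Function.invFun π y) (Function.invFun π z)) :=
                mul_le_mul_of_nonneg_left (httri _ _ _) hκ4
            _ = _ := by ring
        · rw [hdoff x y (fun h => hy h.2), hdoff y z (fun h => hy h.1)]
          simp only [hd, if_pos (And.intro hx hz)]
          linarith [hDt (Function.invFun π x) (Function.invFun π z), hD0]
      · rw [hdoff x z (fun h => hx h.1), hdoff x y (fun h => hx h.1)]
        linarith [hd0' y z]
    · rw [hdoff x z (fun h => hz h.2), hdoff y z (fun h => hz h.2)]
      linarith [hd0' x y]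
  · -- uniform summability
    intro x
    have hoff : ∀ y, ¬ (x ∈ Set.range π ∧ y ∈ Set.range π) → Real.exp (-(1 * d x y)) ≤ Real.exp (-(Fintype.card E : ℝ)) := by
      intro y hxy
      rw [hdoff x y hxy, one_mul, Real.exp_le_exp]
      linarith
    have hcardE : ∑ _y : E, Real.exp (-(Fintype.card E : ℝ)) ≤ 1 := by
      rw [Finset.sum_const, Finset.card_univ, nsmul_eq_mul]
      exact natCast_mul_exp_neg_le_one _
    by_cases hx : x ∈ Set.range π
    · obtain ⟨b, rfl⟩ := hx
      rw [← Finset.sum_filter_add_sum_filter_not Finset.univ (fun y => y ∈ Set.range π)]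
      have hA : ∑ y ∈ Finset.univ.filter (fun y => y ∈ Set.range π), Real.exp (-(1 * d (π b) y)) ≤ C₁ := by
        have hset : Finset.univ.filter (fun y => y ∈ Set.range π) = Finset.univ.image π := by
          ext y; simp [Set.mem_range, eq_comm]
        rw [hset, Finset.sum_image fun b₁ _ b₂ _ h => hπ h]
        refine le_trans (le_of_eq (Finset.sum_congr rfl fun b' _ => ?_)) (hsum b)
        rw [hdπ, one_mul]
      have hB : ∑ y ∈ Finset.univ.filter (fun y => ¬ y ∈ Set.range π), Real.exp (-(1 * d (π b) y)) ≤ 1 := by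
        refine le_trans (Finset.sum_le_sum fun y hy => hoff y ?_) ((Finset.sum_le_univ_sum_of_nonneg fun _ => (Real.exp_pos _).le).trans hcardE)
        exact fun h => (Finset.mem_filter.mp hy).2 h.2
      linarith
    · calc ∑ y, Real.exp (-(1 * d x y)) ≤ ∑ _y : E, Real.exp (-(Fintype.card E : ℝ)) :=
            Finset.sum_le_sum fun y _ => hoff y fun h => hx h.1
        _ ≤ 1 := hcardE
        _ ≤ C₁ + 1 := by linarith
  · -- the anchor is comparable
    intro b b'; rw [hdπ, one_mul]
  · -- ℓ ≥ 0
    intro X; simp only [hℓ]; split_ifs <;> norm_num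
  · -- one-pin sums of ℓ
    intro e
    rw [Finset.sum_ite_eq']
    split_ifs <;> norm_num
  · -- two-pin sums of h
    intro e e'; simp
  · -- Lipschitz
    intro X U V _ _
    by_cases hX : X = Finset.univ
    · subst hX; simp only [hT', hℓ, if_true, one_mul]; exact abs_sum_apply_sub_le _ _ _
    · simp [hT', hℓ, hX]
  · -- C¹·¹
    intro X U V W Z _ _ _ _
    by_cases hX : X = Finset.univ
    · subst hX; simp only [hT', hℓ, if_true, one_mul, zero_mul, zero_add]; exact abs_sum_apply_sub_sub_add_le _ _ _ _ _
    · simp [hT', hℓ, hX]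
  · -- one-bond response
    intro b U V hU hV hUV e
    by_cases he : e ∈ Set.range π
    · obtain ⟨b'', rfl⟩ := he
      rw [hMπ, hMπ, hdπ]
      have h1 : ‖(fun _ : Fin 8 => f b'' U) - (fun _ : Fin 8 => f b'' V)‖ = |f b'' U - f b'' V| := by
        rw [show ((fun _ : Fin 8 => f b'' U) - fun _ : Fin 8 => f b'' V) = fun _ => f b'' U - f b'' V from rfl,
          pi_norm_const, Real.norm_eq_abs]
      rw [h1]
      refine (hR1 b U V hU hV hUV b'').trans ?_
      have h2 := hiv b'' b
      rw [htsymm] at h2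
      refine h2.trans (mul_le_mul_of_nonneg_left (Real.exp_le_exp.mpr ?_) hφ)
      nlinarith [mul_nonneg hκ.le (ht0 b b'')]
    · rw [hMoff U e he, hMoff V e he, sub_zero, norm_zero]
      positivity
  · -- mixed two-bond response
    intro b b' U V W Z hU hV hW hZ hUV hUW hVZ hWZ e
    by_cases he : e ∈ Set.range π
    · obtain ⟨b'', rfl⟩ := he
      rw [hMπ, hMπ, hMπ, hMπ, hdπ, hdπ]
      have h1 : ‖(fun _ : Fin 8 => f b'' U) - (fun _ : Fin 8 => f b'' W) - (fun _ : Fin 8 => f b'' V) + (fun _ : Fin 8 => f b'' Z)‖ =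
          |f b'' U - f b'' W - f b'' V + f b'' Z| := by
        rw [show ((fun _ : Fin 8 => f b'' U) - (fun _ : Fin 8 => f b'' W) - (fun _ : Fin 8 => f b'' V) + fun _ : Fin 8 => f b'' Z) =
            fun _ => f b'' U - f b'' W - f b'' V + f b'' Z from rfl, pi_norm_const, Real.norm_eq_abs]
      rw [h1]
      have hw' := hw U hU
      have h3 := hR2 b b' U V W Z hU hV hW hZ hUV hUW hVZ hWZ b''
      have hS1 : ∑ X ∈ Finset.univ.filter (fun X => b'' ∈ X ∧ (b ∈ X ∧ b' ∈ X)), w X ≤ φ * Real.exp (-(κ * t b b'')) := by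
        have h2 := hiv b'' b
        rw [htsymm] at h2
        refine le_trans (Finset.sum_le_sum_of_subset_of_nonneg ?_ fun X _ _ => hw' X) h2
        intro X; simp only [Finset.mem_filter, Finset.mem_univ, true_and]; tauto
      have hS2 : ∑ X ∈ Finset.univ.filter (fun X => b'' ∈ X ∧ (b ∈ X ∧ b' ∈ X)), w X ≤ φ * Real.exp (-(κ * t b'' b')) := by
        refine le_trans (Finset.sum_le_sum_of_subset_of_nonneg ?_ fun X _ _ => hw' X) (hiv b'' b')
        intro X; simp only [Finset.mem_filter, Finset.mem_univ, true_and]; tauto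
      have h4 := le_mul_exp_half_add hφ hκ.le hS1 hS2
      linarith
    · rw [hMoff U e he, hMoff V e he, hMoff W e he, hMoff Z e he, sub_zero, sub_zero, add_zero, norm_zero]
      positivity
  · -- resummation
    intro U
    have h1 : ∑ X, T' X (M U) = T' Finset.univ (M U) := by
      rw [Finset.sum_eq_single Finset.univ (fun X _ hX => by simp [hT', hX]) (fun h => (h (Finset.mem_univ _)).elim)]
    have h2 : T' Finset.univ (M U) = ∑ b, f b U := by
      simp only [hT', if_true, hM]
      exact Finset.sum_fiberwise Finset.univ π (fun b => f b U)
    have h3 : ∑ b, f b U = ∑ X : Finset β, (X.card : ℝ) * (T X U / (X.card : ℝ)) := by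
      simp only [hf]
      rw [show (∑ b : β, ∑ X ∈ Finset.univ.filter (fun X => b ∈ X), T X U / (X.card : ℝ)) =
          ∑ b : β, ∑ X : Finset β, if b ∈ X then T X U / (X.card : ℝ) else 0 from
          Finset.sum_congr rfl fun b _ => Finset.sum_filter _ _, Finset.sum_comm]
      refine Finset.sum_congr rfl fun X _ => ?_
      rw [Finset.sum_ite_mem, Finset.univ_inter, Finset.sum_const, nsmul_eq_mul]
    have h4 : ∑ X : Finset β, (X.card : ℝ) * (T X U / (X.card : ℝ)) = ∑ X, T X U - T ∅ U := by
      rw [← Finset.add_sum_erase Finset.univ _ (Finset.mem_univ ∅), ← Finset.add_sum_erase Finset.univ (fun X => T X U) (Finset.mem_univ ∅)]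
      rw [Finset.card_empty, Nat.cast_zero, zero_mul, zero_add, add_sub_cancel_left]
      refine Finset.sum_congr rfl fun X hX => ?_
      have hX' : X ≠ ∅ := Finset.ne_of_mem_erase hX
      have hc : (X.card : ℝ) ≠ 0 := by exact_mod_cast (Finset.nonempty_iff_ne_empty.mpr hX').card_pos.ne'
      rw [mul_div_cancel₀ _ hc]
    rw [h1, h2, h3, h4]

end Summit.QuantumFields.YangMills.Theorems.FluctuationComparisonRegPrIntLBackgroundFormOfPolymerPackage

end
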